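import Summits.HodgeConjecture.HodgeConjecture.Theorems.R90S6TypeTwoCayleyShift              -- ★ B2 (p864392): `conj_mem_adjoin_conj`; brings ★ B1 pattern algebra + the ★ Möbius-shift toolbox + ★ charpoly congruence
import Literature.NumberTheory.Automorphic.UnitaryThreeAnisotropicNormalForm                   -- ★ (d1) `exists_smul_one_inv_mul_conj_mem_stabilizer`, `map_mul_self_eq_one_of_mulVec_eq_smul`
import Literature.NumberTheory.Automorphic.UnitaryThreeAnisotropicNormalFormExponents          -- ★ (d2) `model_trace_det_of_normalForm`, `v_model_invariants_eq`; brings ★ stabilizer bounds ∕ relations ∕ coordinates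
import Literature.NumberTheory.Automorphic.UnitOrbitalIntegralUnfoldingAnisotropic            -- ★ `mem_stabilizer_anisoVec_iff`
import HarnessLib

/-!
# R90 · S6 — LINE G1 «geometric fixed subtree», RUNG 2 ODD EDITION, FILE B1: THE ODD CAYLEY BLOCK OF A TYPE-(2) ELEMENT WITH ODD EIGENLINE —
# the block frame of `Stab(w₀)`, the `2 × 2` Möbius block on the ANISOTROPIC plane, and the block-frame data (`Theorems/R90S6TypeTwoCayleyBlockOdd.lean`)

Cell `hodgecm-mathlib`, crux H413 (`stmt-HodgeConjecture-24833`), route of record `HCCMUnconditional`; programme R90-TF, section S6 (base `R90-C14`), seat R90-C14-p07 (g2,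
heir of g0); S6 dealer R90-C14-plan (g2) CARD (G2-ODD) «G1 RUNG 2 ODD EDITION» (2026-09-05T02:52:41Z; census 02:56:51Z «=», GO 02:58:02Z; FILE A `R90S6TorusFixedHyperspecialCountTypeTwoOdd` p864978): FILE B of the card in two parts mirroring ★ B1∕B2 — THIS FILE B1 = the frame, the block and the data; FILE B2 = `R90S6TypeTwoCayleyShiftOdd` (the ODD
twins of ★ B2's (R2.c) `exists_cayleyShift_of_typeTwo` and (R2.d) `norm_eq_one_and_charpoly_congr_of_typeTwo`, same binders with `hx : v (B₀ σ 3 x x) = exp (2k+1)`) — over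
the `κ = −1` normal form ★ (d1) instead of the ramified-torus literal (which needs the EVEN eigenline).  Helper lane `--supports stmt-HodgeConjecture-24833 --as helper`; THEOREMS
ONLY (no definition, no instance, no notation, no named fact, no `sorry`); imports = ★ B2 + ★ (d1) + ★ (d2) + ★ `UnitOrbitalIntegralUnfoldingAnisotropic` + HarnessLib.

THE MATHEMATICS [Kottwitz1986BaseChangeUnits, §1 pp. 240–241; Rogawski1990, §4.9 Prop. 4.9.1 (b) p. 55; Flicker1998UnitaryFL, §6, Prop. 16 p. 96, Theorem 18 p. 97;
Weyl1939, Chap. II §10].  `K` non-dyadic valued (`hd : LocalConjDatum σ ϖ`), `U = U(σ, J₀)(K)`.  A type-(2) `γ ∈ U` (`γx = ux`, exponents `|(trγ − u)² − 4detγ∕u| = |ϖ^{2N+1}|`,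
`|u² − (trγ − u)u + detγ∕u| = |ϖ^n|`, `2 ≤ n`, `1 ≤ N`) with ODD eigenline `|B₀(x,x)| = |ϖ|^{2k+1}` has the `κ = −1` normal form ★ (d1): `u⁻¹·g⁻¹γg = t′ ∈ Stab(w₀)`,
`w₀ = (1,0,−2ϖ)`, `t′ = (1+2ϖb, q, b; 2ϖr, s, r; 4ϖ²b, 2ϖq, 1+2ϖb)`.  (§1) THE BLOCK FRAME `F = [f₁ | w₀ | f₂]`, `f₁ = (1,0,2ϖ)`, `f₂ = e₁` (`w₀^⊥ = ⟨f₁, f₂⟩`, form `diag(4ϖ, 1)`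
— ANISOTROPIC, not unimodular): `t′F = F·(A 0 q; 0 1 0; 4ϖr 0 s)`, `A = 1 + 4ϖb`, `det F = 4ϖ`; so `u⁻¹γ = P·pattern(g₂, 1)·P⁻¹`, `P = gF`, with the `2 × 2` MODEL
`g₂ = (A q; 4ϖr s)` of ★ (d2) (`tr g₂ = T∕u`, `det g₂ = D∕u²`, `T = trγ − u`, `D = detγ∕u`).  (§2) THE ODD CAYLEY BLOCK: `X₂ = ϖ⁻¹(g₂ − 1) = (4b, q∕ϖ; 4r, (s−1)∕ϖ)` is integral
(`|A−1|, |s−1| ≤ |ϖ|` from `n ≥ 2`; `|q| = |r| = |ϖ|^N`, `N ≥ 1`), its trace is residually `σ`-skew (`A + σA − 2 = −N(A−1) − 4ϖN(r)`, `s + σs − 2 = −N(s−1) − 4ϖN(q)` from ★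
`stabilizer_unitarity_relations`) and `|tr X₂² − 4det X₂| = |ϖ|^{2N−1} < 1`, so ★ `valued_det_two_smul_one_add_shift_smul_eq_one` makes the cofactors `det(2 + (ϖ∓1)X₂)` units
and the Möbius block `Φ = (2 + (ϖ+1)X₂)(2 + (ϖ−1)X₂)⁻¹` carries `(n−2, N−1)` (★ `valued_disc_moebius`, ★ `valued_eval_charpoly_moebius`).  (§3) THE BLOCK-FRAME DATA
`blockFrame_of_typeTwo_odd`: `σu·u = 1`, `|u| = 1`, `∃ P b q r s` with `u⁻¹γ = P·pattern(g₂,1)·P⁻¹`, the norm relations, the sizes and the model exponents — everything FILE B2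
needs, the `κ = −1` normal form consumed once.
HONEST LABEL: an assembly over ★ abstract lemmas in S6's letters; count-neutral; consumed by FILE B2 ((R2.c)∕(R2.d)-odd) and FILE C (the odd closed form).  HC_CM is proved
only modulo the 7 printed citations (2 remaining named inputs: hLiu418 = stmt-HodgeConjecture-24832, h413 = stmt-HodgeConjecture-24833) until rung 0 closes.

## References
* [Kottwitz1986BaseChangeUnits] R. E. Kottwitz, *Base change for unit elements of Hecke algebras*, Compositio Math. 60 (1986) 237–250, §1 pp. 240–241.
* [Rogawski1990] J. D. Rogawski, *Automorphic Representations of Unitary Groups in Three Variables*, Ann. of Math. Stud. 123 (1990), §4.9 Prop. 4.9.1 (b) p. 55.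
* [Flicker1998UnitaryFL] Y. Z. Flicker, *Elementary proof of the fundamental lemma for a unitary group*, Canad. J. Math. 50 (1998), §6; Prop. 16 p. 96; Theorem 18 p. 97.
* [Weyl1939] H. Weyl, *The Classical Groups* (1939), Chap. II §10 (Cayley's rational parametrisation).
-/
set_option autoImplicit false
-- the mandated namespace repeats the single-problem summit's segment (`HodgeConjecture.HodgeConjecture`)
set_option linter.dupNamespace false

noncomputable section

open Matrix Polynomial
open Literature.NumberTheory.Automorphic Literature.NumberTheory.Automorphic.HermitianLattice Literature.NumberTheory.Automorphic.UnitaryGroup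
open Literature.NumberTheory.Automorphic.MoebiusShift Literature.NumberTheory.Automorphic.UnitaryLatticeTree
open scoped Matrix MatrixGroups WithZero ValuativeRel

namespace Summit.HodgeConjecture.HodgeConjecture.R90.S6

/-! ### §1 The block frame of `Stab(w₀)` -/

section Frame

variable {K : Type*} [Field K]

/-- **THE BLOCK FRAME**: with `F = [f₁ | w₀ | f₂]`, `f₁ = (1,0,2ϖ)`, `w₀ = (1,0,−2ϖ)`, `f₂ = e₁`, an element of `Stab(w₀)` in its coordinates `(b,q,r,s)` satisfies
`t′·F = F·(A 0 q; 0 1 0; 4ϖr 0 s)`, `A = 1 + 4ϖb` — the `2 × 2` model `(A q; 4ϖr s)` on `w₀^⊥ = ⟨f₁, f₂⟩` in ★ B1's pattern shape. [cite: Flicker1998UnitaryFL, Prop. 16 p. 96] -/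
theorem stabilizerCoords_mul_blockFrame (ϖ b q r s : K) :
    (!![1 + 2 * ϖ * b, q, b; 2 * ϖ * r, s, r; 4 * ϖ ^ 2 * b, 2 * ϖ * q, 1 + 2 * ϖ * b] : Matrix (Fin 3) (Fin 3) K) * !![(1 : K), 1, 0; 0, 0, 1; 2 * ϖ, -(2 * ϖ), 0] =
      !![(1 : K), 1, 0; 0, 0, 1; 2 * ϖ, -(2 * ϖ), 0] * !![1 + 4 * ϖ * b, 0, q; 0, 1, 0; 4 * ϖ * r, 0, s] := by
  ext i j
  fin_cases i <;> fin_cases j <;> simp [Matrix.mul_apply, Fin.sum_univ_three] <;> ring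

/-- `det F = 4ϖ` for the block frame `F = [f₁ | w₀ | f₂]`. [cite: Flicker1998UnitaryFL, Prop. 16 p. 96] -/
theorem det_blockFrame (ϖ : K) : (!![(1 : K), 1, 0; 0, 0, 1; 2 * ϖ, -(2 * ϖ), 0] : Matrix (Fin 3) (Fin 3) K).det = 4 * ϖ := by
  rw [Matrix.det_fin_three]
  simp
  ring

end Frame

/-! ### §2 The odd `2 × 2` Cayley block (anisotropic plane `diag(4ϖ, 1)`) -/

section BlockOdd

variable {K : Type*} [Field K] [Valued K ℤᵐ⁰] {σ : K →+* K} {ϖ : K}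

/-- **THE ODD `2 × 2` CAYLEY BLOCK.**  For the model `g₂ = (A q; 4ϖr s)`, `A = 1 + 4ϖb`, of an element of `Stab(w₀)` (norm relations `N(A) + 4ϖN(r) = 1`, `N(s) + 4ϖN(q) = 1`)
with `|A − 1|, |s − 1|, |q|, |r| ≤ |ϖ|` and exponents `|tr g₂² − 4 det g₂| = |ϖ|^{2N+1}`, `|χ_{g₂}(1)| = |ϖ|^n`, `1 ≤ N`, `2 ≤ n`: `X₂ = ϖ⁻¹(g₂ − 1)` is integral, the cofactors
`det(2 + (ϖ∓1)X₂)` are units, and the Möbius block `Φ = (2 + (ϖ+1)X₂)(2 + (ϖ−1)X₂)⁻¹` has `|tr Φ² − 4 det Φ| = |ϖ^{2(N−1)+1}|`, `|χ_Φ(1)| = |ϖ^{n−2}|`.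
[cite: Kottwitz1986BaseChangeUnits, §1 pp. 240–241] [cite: Flicker1998UnitaryFL, §6; Prop. 16 p. 96] [cite: Weyl1939, Chap. II §10] -/
theorem cayleyBlock_two_odd (hd : LocalConjDatum σ ϖ) {b q r s : K}
    (RA : σ (1 + 4 * ϖ * b) * (1 + 4 * ϖ * b) + 4 * ϖ * (σ r * r) = 1) (Rs : σ s * s + 4 * ϖ * (σ q * q) = 1)
    (hb : Valued.v (4 * ϖ * b) ≤ Valued.v ϖ) (hs1 : Valued.v (s - 1) ≤ Valued.v ϖ) (hq : Valued.v q ≤ Valued.v ϖ) (hr : Valued.v r ≤ Valued.v ϖ)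
    {N n : ℕ} (hN1 : 1 ≤ N) (hn2 : 2 ≤ n)
    (hN₂ : Valued.v ((!![1 + 4 * ϖ * b, q; 4 * ϖ * r, s] : Matrix (Fin 2) (Fin 2) K).trace ^ 2 - 4 * (!![1 + 4 * ϖ * b, q; 4 * ϖ * r, s] : Matrix (Fin 2) (Fin 2) K).det) =
      WithZero.exp (-((2 * N + 1 : ℕ) : ℤ)))
    (hn₂ : Valued.v ((!![1 + 4 * ϖ * b, q; 4 * ϖ * r, s] : Matrix (Fin 2) (Fin 2) K).charpoly.eval 1) = WithZero.exp (-(n : ℤ)))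
    (X₂ : Matrix (Fin 2) (Fin 2) K) (hX₂ : X₂ = ϖ⁻¹ • ((!![1 + 4 * ϖ * b, q; 4 * ϖ * r, s] : Matrix (Fin 2) (Fin 2) K) - 1))
    (Φ : Matrix (Fin 2) (Fin 2) K) (hΦ : Φ = ((2 : K) • (1 : Matrix (Fin 2) (Fin 2) K) + (ϖ + 1) • X₂) * ((2 : K) • (1 : Matrix (Fin 2) (Fin 2) K) + (ϖ - 1) • X₂)⁻¹) :
    (∀ i j, Valued.v (X₂ i j) ≤ 1) ∧
      Valued.v (((2 : K) • (1 : Matrix (Fin 2) (Fin 2) K) + (ϖ - 1) • X₂).det) = 1 ∧ Valued.v (((2 : K) • (1 : Matrix (Fin 2) (Fin 2) K) + (ϖ + 1) • X₂).det) = 1 ∧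
      Valued.v (Φ.trace ^ 2 - 4 * Φ.det) = Valued.v (ϖ ^ (2 * (N - 1) + 1)) ∧
      Valued.v (Φ.charpoly.eval 1) = Valued.v (ϖ ^ (n - 2)) := by
  have hϖ0 : ϖ ≠ 0 := hd.ϖ_ne_zero
  have hvϖ := hd.vϖ
  have hvpow : ∀ j : ℕ, Valued.v (ϖ ^ j) = WithZero.exp (-(j : ℤ)) := fun j => by
    rw [map_pow, hvϖ, ← WithZero.exp_nsmul, nsmul_eq_mul, mul_neg, mul_one]
  obtain ⟨-, hvϖ1, -, -, -, -⟩ := shift_parameter_facts hvϖ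
  have h20 : (2 : K) ≠ 0 := fun h0 => by have := hd.v2; rw [h0, map_zero] at this; exact zero_ne_one this
  have hv4 : Valued.v (4 : K) = 1 := by rw [show (4 : K) = 2 * 2 by norm_num, map_mul, hd.v2, one_mul]
  set A : K := 1 + 4 * ϖ * b with hA
  set g₂ : Matrix (Fin 2) (Fin 2) K := !![A, q; 4 * ϖ * r, s] with hg₂def
  -- `1 + ϖX₂ = g₂`
  have hg₂ : (1 : Matrix (Fin 2) (Fin 2) K) + ϖ • X₂ = g₂ := by rw [hX₂]; exact (eq_one_add_smul_inv_smul_sub_one hϖ0 _).symm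
  -- the sizes in `exp` form
  have hA1 : Valued.v (A - 1) ≤ WithZero.exp (-1 : ℤ) := by rw [hA, add_sub_cancel_left, ← hvϖ]; exact hb
  have hs1' : Valued.v (s - 1) ≤ WithZero.exp (-1 : ℤ) := hvϖ ▸ hs1
  have hq' : Valued.v q ≤ WithZero.exp (-1 : ℤ) := hvϖ ▸ hq
  have hr' : Valued.v r ≤ WithZero.exp (-1 : ℤ) := hvϖ ▸ hr
  have hr1 : Valued.v r ≤ 1 := hr.trans hvϖ1.le
  have hq1 : Valued.v q ≤ 1 := hq.trans hvϖ1.le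
  -- integrality of `X₂`
  have hX₂int : ∀ i j, Valued.v (X₂ i j) ≤ 1 := by
    rw [hX₂]
    refine forall_valued_inv_smul_sub_one_le_one hϖ0 fun i j => ?_
    fin_cases i <;> fin_cases j
    · show Valued.v ((g₂ - 1) 0 0) ≤ _
      have e : (g₂ - 1) 0 0 = A - 1 := by simp [hg₂def]
      rw [e, hvϖ]; exact hA1
    · show Valued.v ((g₂ - 1) 0 1) ≤ _
      have e : (g₂ - 1) 0 1 = q := by simp [hg₂def]
      rw [e]; exact hq
    · show Valued.v ((g₂ - 1) 1 0) ≤ _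
      have e : (g₂ - 1) 1 0 = 4 * ϖ * r := by simp [hg₂def]
      rw [e, map_mul, map_mul, hv4, one_mul]
      exact mul_le_of_le_one_right' hr1
    · show Valued.v ((g₂ - 1) 1 1) ≤ _
      have e : (g₂ - 1) 1 1 = s - 1 := by simp [hg₂def]
      rw [e]; exact hs1
  -- the trace of `X₂` is residually `σ`-skew
  have htr : X₂.trace = ϖ⁻¹ * ((A - 1) + (s - 1)) := by
    rw [hX₂, Matrix.trace_smul, Matrix.trace_sub, Matrix.trace_one, hg₂def, Matrix.trace_fin_two_of, smul_eq_mul, Fintype.card_fin]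
    push_cast; ring
  have hσtr : σ X₂.trace = ϖ⁻¹ * ((σ A - 1) + (σ s - 1)) := by
    rw [htr, map_mul, map_inv₀, hd.σϖ, map_add, map_sub, map_sub, map_one]
  have hskew : Valued.v (σ X₂.trace + X₂.trace) < 1 := by
    have e : σ X₂.trace + X₂.trace = ϖ⁻¹ * (-((σ A - 1) * (A - 1) + 4 * ϖ * (σ r * r)) - ((σ s - 1) * (s - 1) + 4 * ϖ * (σ q * q))) := by
      rw [hσtr, htr]; linear_combination ϖ⁻¹ * RA + ϖ⁻¹ * Rs
    have hσA1 : Valued.v (σ A - 1) ≤ WithZero.exp (-1 : ℤ) := by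
      rw [show σ A - 1 = σ (A - 1) by rw [map_sub, map_one], hd.vσ]; exact hA1
    have hσs1 : Valued.v (σ s - 1) ≤ WithZero.exp (-1 : ℤ) := by
      rw [show σ s - 1 = σ (s - 1) by rw [map_sub, map_one], hd.vσ]; exact hs1'
    have h22 : WithZero.exp (-1 : ℤ) * WithZero.exp (-1 : ℤ) = WithZero.exp (-2 : ℤ) := by rw [← WithZero.exp_add]; norm_num
    have hXA : Valued.v ((σ A - 1) * (A - 1) + 4 * ϖ * (σ r * r)) ≤ WithZero.exp (-2 : ℤ) := by
      refine (Valuation.map_add _ _ _).trans (max_le ?_ ?_)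
      · rw [map_mul, ← h22]; exact mul_le_mul' hσA1 hA1
      · rw [map_mul, map_mul, hv4, one_mul, hvϖ, map_mul, hd.vσ, ← h22]
        exact mul_le_mul' le_rfl ((mul_le_mul' hr' hr1).trans_eq (mul_one _))
    have hXs : Valued.v ((σ s - 1) * (s - 1) + 4 * ϖ * (σ q * q)) ≤ WithZero.exp (-2 : ℤ) := by
      refine (Valuation.map_add _ _ _).trans (max_le ?_ ?_)
      · rw [map_mul, ← h22]; exact mul_le_mul' hσs1 hs1'
      · rw [map_mul, map_mul, hv4, one_mul, hvϖ, map_mul, hd.vσ, ← h22]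
        exact mul_le_mul' le_rfl ((mul_le_mul' hq' hq1).trans_eq (mul_one _))
    have hsum : Valued.v (-((σ A - 1) * (A - 1) + 4 * ϖ * (σ r * r)) - ((σ s - 1) * (s - 1) + 4 * ϖ * (σ q * q))) ≤ WithZero.exp (-2 : ℤ) := by
      refine (Valuation.map_sub _ _ _).trans (max_le ?_ hXs)
      rw [Valuation.map_neg]; exact hXA
    rw [e, map_mul, map_inv₀, hvϖ]
    calc (WithZero.exp (-1 : ℤ))⁻¹ * Valued.v (-((σ A - 1) * (A - 1) + 4 * ϖ * (σ r * r)) - ((σ s - 1) * (s - 1) + 4 * ϖ * (σ q * q)))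
        ≤ (WithZero.exp (-1 : ℤ))⁻¹ * WithZero.exp (-2 : ℤ) := by gcongr
      _ = WithZero.exp (-1 : ℤ) := by rw [← WithZero.exp_neg, ← WithZero.exp_add]; norm_num
      _ < 1 := hvϖ ▸ hvϖ1
  -- the discriminant of `X₂`: `|tr X₂² − 4 det X₂| = |ϖ|^{2N−1} < 1`
  have hdiscX : Valued.v (X₂.trace ^ 2 - 4 * X₂.det) < 1 := by
    have hdet : X₂.det = ϖ⁻¹ * (A - 1) * (ϖ⁻¹ * (s - 1)) - ϖ⁻¹ * q * (ϖ⁻¹ * (4 * ϖ * r)) := by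
      rw [hX₂, Matrix.det_fin_two]
      simp [hg₂def]
    have htrg : g₂.trace = A + s := by rw [hg₂def, Matrix.trace_fin_two_of]
    have hdetg : g₂.det = A * s - q * (4 * ϖ * r) := by rw [hg₂def, Matrix.det_fin_two_of]
    have e : X₂.trace ^ 2 - 4 * X₂.det = ϖ⁻¹ ^ 2 * (g₂.trace ^ 2 - 4 * g₂.det) := by
      rw [htr, hdet, htrg, hdetg]; ring
    rw [e, map_mul, map_pow, map_inv₀, hvϖ, hN₂, ← WithZero.exp_neg, ← WithZero.exp_nsmul, ← WithZero.exp_add, ← WithZero.exp_zero, WithZero.exp_lt_exp]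
    simp only [nsmul_eq_mul]; push_cast; omega
  -- ★ the cofactors are units; the denominators; the dictionary
  obtain ⟨hm, hp⟩ := valued_det_two_smul_one_add_shift_smul_eq_one σ hd.vσ hd.v2 hvϖ hX₂int hskew hdiscX
  obtain ⟨hDm, -⟩ := valued_det_shift_denominators hvϖ (X := X₂) hm hp
  have hN₂' : Valued.v (((1 : Matrix (Fin 2) (Fin 2) K) + ϖ • X₂).trace ^ 2 - 4 * ((1 : Matrix (Fin 2) (Fin 2) K) + ϖ • X₂).det) =
      WithZero.exp (-((2 * N + 1 : ℕ) : ℤ)) := by rw [hg₂]; exact hN₂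
  have hn₂' : Valued.v (((1 : Matrix (Fin 2) (Fin 2) K) + ϖ • X₂).charpoly.eval 1) = WithZero.exp (-(n : ℤ)) := by rw [hg₂]; exact hn₂
  have hdisc := valued_disc_moebius hd.v2 hvϖ ((1 : Matrix (Fin 2) (Fin 2) K) + ϖ • X₂) hDm hN1 hN₂'
  have hu1 : Valued.v ((ϖ - 1) * 1 + (ϖ + 1)) = WithZero.exp (-1 : ℤ) := by
    rw [show (ϖ - 1) * 1 + (ϖ + 1) = 2 * ϖ by ring, map_mul, hd.v2, one_mul, hvϖ]
  have heval := valued_eval_charpoly_moebius hd.v2 hvϖ ((1 : Matrix (Fin 2) (Fin 2) K) + ϖ • X₂) 1 hDm hu1 hn2 hn₂'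
  have hφ1 : ((ϖ + 1) * 1 + (ϖ - 1)) / ((ϖ - 1) * 1 + (ϖ + 1)) = 1 := by
    rw [show (ϖ + 1) * 1 + (ϖ - 1) = (ϖ - 1) * 1 + (ϖ + 1) by ring]
    exact div_self (by rw [show (ϖ - 1) * 1 + (ϖ + 1) = 2 * ϖ by ring]; exact mul_ne_zero h20 hϖ0)
  rw [hφ1] at heval
  have hmU : IsUnit (((2 : K) • (1 : Matrix (Fin 2) (Fin 2) K) + (ϖ - 1) • X₂).det) :=
    isUnit_iff_ne_zero.2 fun h0 => by rw [h0, map_zero] at hm; exact zero_ne_one hm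
  have hmoeb : ((ϖ + 1) • ((1 : Matrix (Fin 2) (Fin 2) K) + ϖ • X₂) + (ϖ - 1) • (1 : Matrix (Fin 2) (Fin 2) K)) *
      ((ϖ - 1) • ((1 : Matrix (Fin 2) (Fin 2) K) + ϖ • X₂) + (ϖ + 1) • (1 : Matrix (Fin 2) (Fin 2) K))⁻¹ = Φ := by
    rw [hΦ]; exact moebius_one_add_smul_eq X₂ hϖ0 hmU
  rw [hmoeb] at hdisc heval
  exact ⟨hX₂int, hm, hp, by rw [hdisc, hvpow], by rw [heval, hvpow]⟩

end BlockOdd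

/-! ### §3 The block-frame data of a type-(2) element with odd eigenline -/

section FrameData

variable {K : Type*} [Field K] [Valued K ℤᵐ⁰]

set_option maxHeartbeats 400000 in
-- the ★ (d1) normal-form term and a dozen valuation estimates in one proof
/-- **THE BLOCK-FRAME DATA OF A TYPE-(2) ELEMENT WITH ODD EIGENLINE.**  For a type-(2) `γ ∈ U(σ, J₀)(K)` (`γx = ux`, `|B₀(x,x)| = |ϖ|^{2k+1}` odd, exponents `(n, N)` in
★ a₀'s letters, `2 ≤ n`, `1 ≤ N`): `σu·u = 1`, `|u| = 1`, and there are an invertible `P` and `b q r s` with `u⁻¹γ = P·(A 0 q; 0 1 0; 4ϖr 0 s)·P⁻¹`, `A = 1 + 4ϖb` (★ (d1) +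
the block frame of §1), the two norm relations of `Stab(w₀)` (★ `stabilizer_unitarity_relations`), the sizes `|A − 1|, |s − 1|, |q|, |r| ≤ |ϖ|` (★ (d2), ★ stabilizer bounds,
`n ≥ 2`), and the exponents of the `2 × 2` model `g₂ = (A q; 4ϖr s)`: `|tr g₂² − 4 det g₂| = |ϖ|^{2N+1}`, `|χ_{g₂}(1)| = |ϖ|^n` (★ (d2): `tr g₂ = T∕u`, `det g₂ = D∕u²`).
[cite: Flicker1998UnitaryFL, Prop. 16 p. 96; Theorem 18 p. 97] [cite: Rogawski1990, §4.9 Prop. 4.9.1 (b) p. 55] -/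
theorem blockFrame_of_typeTwo_odd
    [IsDiscreteValuationRing (Valued.integer K)] [Finite (IsLocalRing.ResidueField (Valued.integer K))]
    [IsAdicComplete (IsLocalRing.maximalIdeal (Valued.integer K)) (Valued.integer K)]
    {σ : K →+* K} {ϖ : K} (hd : LocalConjDatum σ ϖ)
    (hσO : ∀ y : Valued.integer K, (σ.comp (Valued.integer K).subtype) y ∈ Valued.integer K)
    {a₀ : Valued.integer K} (ha₀ : IsUnit (((σ.comp (Valued.integer K).subtype).codRestrict (Valued.integer K) hσO) a₀ - a₀))
    {γ : ↥(unitaryGroupOfForm σ ((StdForm.antidiagonal 3).over K))} {x : Fin 3 → K} {u : K}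
    (hγx : (((γ : ↥(unitaryGroupOfForm σ ((StdForm.antidiagonal 3).over K))) : GL (Fin 3) K) : Matrix (Fin 3) (Fin 3) K) *ᵥ x = u • x)
    {k : ℤ} (hx : Valued.v (B₀ σ 3 x x) = WithZero.exp (2 * k + 1))
    {N n : ℕ} (hN : Valued.v ((Matrix.trace (((γ : ↥(unitaryGroupOfForm σ ((StdForm.antidiagonal 3).over K))) : GL (Fin 3) K) : Matrix (Fin 3) (Fin 3) K) - u) ^ 2 -
      4 * (Matrix.det (((γ : ↥(unitaryGroupOfForm σ ((StdForm.antidiagonal 3).over K))) : GL (Fin 3) K) : Matrix (Fin 3) (Fin 3) K) / u)) = Valued.v (ϖ ^ (2 * N + 1)))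
    (hn : Valued.v (u ^ 2 - (Matrix.trace (((γ : ↥(unitaryGroupOfForm σ ((StdForm.antidiagonal 3).over K))) : GL (Fin 3) K) : Matrix (Fin 3) (Fin 3) K) - u) * u +
      Matrix.det (((γ : ↥(unitaryGroupOfForm σ ((StdForm.antidiagonal 3).over K))) : GL (Fin 3) K) : Matrix (Fin 3) (Fin 3) K) / u) = Valued.v (ϖ ^ n))
    (hn2 : 2 ≤ n) (hN1 : 1 ≤ N) :
    σ u * u = 1 ∧ Valued.v u = 1 ∧ ∃ (P : Matrix (Fin 3) (Fin 3) K) (b q r s : K), IsUnit P.det ∧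
      u⁻¹ • (((γ : ↥(unitaryGroupOfForm σ ((StdForm.antidiagonal 3).over K))) : GL (Fin 3) K) : Matrix (Fin 3) (Fin 3) K) =
        P * !![1 + 4 * ϖ * b, 0, q; 0, 1, 0; 4 * ϖ * r, 0, s] * P⁻¹ ∧
      σ (1 + 4 * ϖ * b) * (1 + 4 * ϖ * b) + 4 * ϖ * (σ r * r) = 1 ∧ σ s * s + 4 * ϖ * (σ q * q) = 1 ∧
      Valued.v (4 * ϖ * b) ≤ Valued.v ϖ ∧ Valued.v (s - 1) ≤ Valued.v ϖ ∧ Valued.v q ≤ Valued.v ϖ ∧ Valued.v r ≤ Valued.v ϖ ∧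
      Valued.v ((!![1 + 4 * ϖ * b, q; 4 * ϖ * r, s] : Matrix (Fin 2) (Fin 2) K).trace ^ 2 - 4 * (!![1 + 4 * ϖ * b, q; 4 * ϖ * r, s] : Matrix (Fin 2) (Fin 2) K).det) =
        WithZero.exp (-((2 * N + 1 : ℕ) : ℤ)) ∧
      Valued.v ((!![1 + 4 * ϖ * b, q; 4 * ϖ * r, s] : Matrix (Fin 2) (Fin 2) K).charpoly.eval 1) = WithZero.exp (-(n : ℤ)) := by
  have hϖ0 : ϖ ≠ 0 := hd.ϖ_ne_zero
  have hvϖ := hd.vϖ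
  have hvpow : ∀ j : ℕ, Valued.v (ϖ ^ j) = WithZero.exp (-(j : ℤ)) := fun j => by
    rw [map_pow, hvϖ, ← WithZero.exp_nsmul, nsmul_eq_mul, mul_neg, mul_one]
  have h20 : (2 : K) ≠ 0 := fun h0 => by have := hd.v2; rw [h0, map_zero] at this; exact zero_ne_one this
  have hv4 : Valued.v (4 : K) = 1 := by rw [show (4 : K) = 2 * 2 by norm_num, map_mul, hd.v2, one_mul]
  have hmat : ∀ a b : ↥(unitaryGroupOfForm σ ((StdForm.antidiagonal 3).over K)), (((a * b : ↥(unitaryGroupOfForm σ ((StdForm.antidiagonal 3).over K))) : GL (Fin 3) K) :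
      Matrix (Fin 3) (Fin 3) K) = ((a : GL (Fin 3) K) : Matrix (Fin 3) (Fin 3) K) * ((b : GL (Fin 3) K) : Matrix (Fin 3) (Fin 3) K) := fun a b => by
    rw [Subgroup.coe_mul, Units.val_mul]
  set Γ : Matrix (Fin 3) (Fin 3) K := (((γ : ↥(unitaryGroupOfForm σ ((StdForm.antidiagonal 3).over K))) : GL (Fin 3) K) : Matrix (Fin 3) (Fin 3) K) with hΓ
  -- §0 the letters `T`, `D`; the exponents in `exp` form
  set T : K := Matrix.trace Γ - u with hT
  set D : K := Matrix.det Γ / u with hD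
  have hNexp : Valued.v (T ^ 2 - 4 * D) = WithZero.exp (-((2 * N + 1 : ℕ) : ℤ)) := by rw [hN, hvpow]
  have hnexp : Valued.v (u ^ 2 - T * u + D) = WithZero.exp (-(n : ℤ)) := by rw [hn, hvpow]
  -- §1 the κ = −1 normal form ★ (d1) and its coordinates
  have hB0 : B₀ σ 3 x x ≠ 0 := fun h0 => by
    rw [h0, map_zero] at hx
    exact WithZero.coe_ne_zero hx.symm
  obtain ⟨g, z, hz, -, -, -, ht'S⟩ := exists_smul_one_inv_mul_conj_mem_stabilizer σ rfl hd hσO ha₀ hγx hx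
  obtain ⟨bt, qt, rt, st, ht'c⟩ := exists_coe_eq_of_mulVec_anisoVec_eq σ rfl hd ((mem_stabilizer_anisoVec_iff σ _ _).1 ht'S)
  -- §2 model data ★ (d2), sizes, relations
  have hu1 : σ u * u = 1 := map_mul_self_eq_one_of_mulVec_eq_smul σ rfl γ hγx hB0
  have hu0 : u ≠ 0 := fun h0 => by rw [h0, mul_zero] at hu1; exact zero_ne_one hu1
  have hvu : Valued.v u = 1 := by
    -- `|u|² = 1` in `ℤᵐ⁰` (norm-one scalar, `σ` isometric)
    have h := congrArg Valued.v hu1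
    rw [map_mul, hd.vσ, map_one] at h
    have hvu0 : Valued.v u ≠ 0 := fun h0 => by rw [h0, mul_zero] at h; exact zero_ne_one h
    rw [← WithZero.exp_log hvu0, ← WithZero.exp_add, ← WithZero.exp_zero, WithZero.exp_inj] at h
    rw [← WithZero.exp_log hvu0, ← WithZero.exp_zero]
    congr 1; omega
  have hvu' : Valued.v u⁻¹ = 1 := by rw [map_inv₀, hvu, inv_one]
  have htr : Matrix.trace Γ = T + u := by rw [hT]; ring
  have hdet : Matrix.det Γ = D * u := by rw [hD]; exact (div_mul_cancel₀ _ hu0).symm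
  obtain ⟨hAs, hdet2⟩ := model_trace_det_of_normalForm σ hu0 hz htr hdet ht'c
  obtain ⟨hvdisc, hvtr, hveval⟩ := v_model_invariants_eq σ rfl hd ht'c hu1 hAs hdet2
  obtain ⟨hst1, -, hAt1, -⟩ := stabilizer_valuation_bounds σ rfl hd ht'c
  have hDv : Valued.v (((1 + 4 * ϖ * bt) - st) ^ 2 - 16 * ϖ * (1 + 4 * ϖ * bt) * (σ qt * qt) / σ st) = WithZero.exp (-((2 * N + 1 : ℕ) : ℤ)) := by
    rw [hvdisc]; exact hNexp
  obtain ⟨hqt, hAst⟩ := v_q_eq_and_v_sub_le_of_v_disc σ hd hAt1 hst1 N hDv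
  have hrt : Valued.v rt = WithZero.exp (-(N : ℤ)) := by rw [stabilizer_v_r_eq_v_q σ rfl hd ht'c, hqt]
  obtain ⟨RA, Rs, -⟩ := stabilizer_unitarity_relations σ rfl hd ht'c
  -- the sizes `|A − 1|, |s − 1| ≤ |ϖ|` (from `n ≥ 2`): `|T − 2u|² = |4χ₂(u) + (T² − 4D)| ≤ |ϖ|²`
  have hT2u : Valued.v (T - 2 * u) ≤ Valued.v ϖ := by
    refine v_le_of_sq_le_sq hvϖ ?_
    rw [← map_pow, show (T - 2 * u) ^ 2 = 4 * (u ^ 2 - T * u + D) + (T ^ 2 - 4 * D) by ring]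
    refine (Valuation.map_add _ _ _).trans (max_le ?_ ?_)
    · rw [map_mul, hv4, one_mul, hnexp, hvϖ, ← WithZero.exp_nsmul, WithZero.exp_le_exp]; simp only [nsmul_eq_mul]; push_cast; omega
    · rw [hNexp, hvϖ, ← WithZero.exp_nsmul, WithZero.exp_le_exp]; simp only [nsmul_eq_mul]; push_cast; omega
  have hAs2 : Valued.v ((1 + 4 * ϖ * bt) + st - 2) ≤ Valued.v ϖ := by rw [hvtr]; exact hT2u
  have hAsϖ : Valued.v ((1 + 4 * ϖ * bt) - st) ≤ Valued.v ϖ :=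
    hAst.trans (by rw [hvϖ, WithZero.exp_le_exp]; omega)
  have hb : Valued.v (4 * ϖ * bt) ≤ Valued.v ϖ := by
    have e : 4 * ϖ * bt = 2⁻¹ * (((1 + 4 * ϖ * bt) + st - 2) + ((1 + 4 * ϖ * bt) - st)) := by field_simp; ring
    rw [e, map_mul, map_inv₀, hd.v2, inv_one, one_mul]
    exact (Valuation.map_add _ _ _).trans (max_le hAs2 hAsϖ)
  have hs1 : Valued.v (st - 1) ≤ Valued.v ϖ := by
    have e : st - 1 = 2⁻¹ * (((1 + 4 * ϖ * bt) + st - 2) - ((1 + 4 * ϖ * bt) - st)) := by field_simp; ring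
    rw [e, map_mul, map_inv₀, hd.v2, inv_one, one_mul]
    exact (Valuation.map_sub _ _ _).trans (max_le hAs2 hAsϖ)
  have hq' : Valued.v qt ≤ Valued.v ϖ := by rw [hqt, hvϖ, WithZero.exp_le_exp]; omega
  have hr' : Valued.v rt ≤ Valued.v ϖ := by rw [hrt, hvϖ, WithZero.exp_le_exp]; omega
  -- the `2 × 2` model's exponents
  have hN₂ : Valued.v ((!![1 + 4 * ϖ * bt, qt; 4 * ϖ * rt, st] : Matrix (Fin 2) (Fin 2) K).trace ^ 2 -
      4 * (!![1 + 4 * ϖ * bt, qt; 4 * ϖ * rt, st] : Matrix (Fin 2) (Fin 2) K).det) = WithZero.exp (-((2 * N + 1 : ℕ) : ℤ)) := by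
    rw [Matrix.trace_fin_two_of, Matrix.det_fin_two_of, hAs, show (1 + 4 * ϖ * bt) * st - qt * (4 * ϖ * rt) = (1 + 4 * ϖ * bt) * st - 4 * ϖ * qt * rt by ring, hdet2,
      show (T / u) ^ 2 - 4 * (D / u ^ 2) = u⁻¹ ^ 2 * (T ^ 2 - 4 * D) by field_simp, map_mul, map_pow, hvu', one_pow, one_mul, hNexp]
  have hn₂ : Valued.v ((!![1 + 4 * ϖ * bt, qt; 4 * ϖ * rt, st] : Matrix (Fin 2) (Fin 2) K).charpoly.eval 1) = WithZero.exp (-(n : ℤ)) := by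
    rw [Matrix.charpoly_fin_two, Matrix.trace_fin_two_of, Matrix.det_fin_two_of]
    simp only [eval_add, eval_sub, eval_mul, eval_pow, eval_C, eval_X]
    rw [show (1 : K) ^ 2 - ((1 + 4 * ϖ * bt) + st) * 1 + ((1 + 4 * ϖ * bt) * st - qt * (4 * ϖ * rt)) =
      1 - ((1 + 4 * ϖ * bt) + st) + ((1 + 4 * ϖ * bt) * st - 4 * ϖ * qt * rt) by ring, hveval, hnexp]
  -- §3 the block frame `P = g·F`
  set Gm : Matrix (Fin 3) (Fin 3) K := ((g : GL (Fin 3) K) : Matrix (Fin 3) (Fin 3) K) with hGm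
  have hGu : IsUnit Gm.det := (Matrix.isUnit_iff_isUnit_det Gm).1 (Units.isUnit (g : GL (Fin 3) K))
  have hGinv : (((g⁻¹ : ↥(unitaryGroupOfForm σ ((StdForm.antidiagonal 3).over K))) : GL (Fin 3) K) : Matrix (Fin 3) (Fin 3) K) = Gm⁻¹ := by
    rw [Subgroup.coe_inv, Matrix.coe_units_inv]
  set F : Matrix (Fin 3) (Fin 3) K := !![(1 : K), 1, 0; 0, 0, 1; 2 * ϖ, -(2 * ϖ), 0] with hF
  have hFu : IsUnit F.det := by
    rw [hF, det_blockFrame]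
    exact isUnit_iff_ne_zero.2 (mul_ne_zero (by rw [show (4 : K) = 2 * 2 by norm_num]; exact mul_ne_zero h20 h20) hϖ0)
  set Pat : Matrix (Fin 3) (Fin 3) K := !![1 + 4 * ϖ * bt, 0, qt; 0, 1, 0; 4 * ϖ * rt, 0, st] with hPat
  -- `t′ = F·Pat·F⁻¹`
  have hTF : (!![1 + 2 * ϖ * bt, qt, bt; 2 * ϖ * rt, st, rt; 4 * ϖ ^ 2 * bt, 2 * ϖ * qt, 1 + 2 * ϖ * bt] : Matrix (Fin 3) (Fin 3) K) = F * Pat * F⁻¹ := by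
    have h := stabilizerCoords_mul_blockFrame ϖ bt qt rt st
    rw [← hF, ← hPat] at h
    rw [← h, Matrix.mul_nonsing_inv_cancel_right F _ hFu]
  -- `g⁻¹γg = u·t′`
  have h1 : Gm⁻¹ * Γ * Gm = u • (F * Pat * F⁻¹) := by
    have e : g⁻¹ * γ * g = z * (z⁻¹ * (g⁻¹ * γ * g)) := by group
    have h2 : (((g⁻¹ * γ * g : ↥(unitaryGroupOfForm σ ((StdForm.antidiagonal 3).over K))) : GL (Fin 3) K) : Matrix (Fin 3) (Fin 3) K) = u • (F * Pat * F⁻¹) := by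
      calc (((g⁻¹ * γ * g : ↥(unitaryGroupOfForm σ ((StdForm.antidiagonal 3).over K))) : GL (Fin 3) K) : Matrix (Fin 3) (Fin 3) K)
          = (((z * (z⁻¹ * (g⁻¹ * γ * g)) : ↥(unitaryGroupOfForm σ ((StdForm.antidiagonal 3).over K))) : GL (Fin 3) K) : Matrix (Fin 3) (Fin 3) K) := by rw [← e]
        _ = ((z : GL (Fin 3) K) : Matrix (Fin 3) (Fin 3) K) *
              (((z⁻¹ * (g⁻¹ * γ * g) : ↥(unitaryGroupOfForm σ ((StdForm.antidiagonal 3).over K))) : GL (Fin 3) K) : Matrix (Fin 3) (Fin 3) K) := hmat _ _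
        _ = u • (F * Pat * F⁻¹) := by rw [hz, ht'c, Matrix.smul_mul, Matrix.one_mul, hTF]
    rw [hmat, hmat, hGinv, ← hΓ, ← hGm] at h2
    exact h2
  refine ⟨hu1, hvu, Gm * F, bt, qt, rt, st, by rw [Matrix.det_mul]; exact hGu.mul hFu, ?_, RA, Rs, hb, hs1, hq', hr', hN₂, hn₂⟩
  -- `u⁻¹γ = (gF)·Pat·(gF)⁻¹`
  have e : Γ = Gm * (Gm⁻¹ * Γ * Gm) * Gm⁻¹ := by
    rw [← Matrix.mul_assoc, ← Matrix.mul_assoc, Matrix.mul_nonsing_inv Gm hGu, Matrix.one_mul, Matrix.mul_nonsing_inv_cancel_right Gm _ hGu]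
  rw [e, h1, Matrix.mul_smul, Matrix.smul_mul, smul_smul, inv_mul_cancel₀ hu0, one_smul, ← hPat, Matrix.mul_inv_rev]
  simp only [Matrix.mul_assoc]

end FrameData

end Summit.HodgeConjecture.HodgeConjecture.R90.S6

end
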